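import Summits.BirchSwinnertonDyer.BirchSwinnertonDyer.Theses.PrintX10b
import Summits.BirchSwinnertonDyer.BirchSwinnertonDyer.Theorems.PrintX10bHowardContainmentLightFrameX10bOfMuStabilized
import Summits.BirchSwinnertonDyer.BirchSwinnertonDyer.Theorems.PrintX9MuPartStabilizedDefs
import Summits.BirchSwinnertonDyer.Rank1Residual.X9.LeafDischargeScalarImage
import Summits.BirchSwinnertonDyer.Rank1Residual.X10.LeafDischargeX10b
import HarnessLib

/-!
# Line `torsion-depth-x10b-pinned`, skeleton v3 (x10b-p2 LEAD g3, after plan g10 THE CUT 10:51:14Z) on the DECIDING crux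
# stmt-BirchSwinnertonDyer-27275 `PrintX10b.HowardContainmentLightFrameX10bPinnedOfPrint` (PrintX10b rev 37; SPLIT gen 1,
# resplit into {shared μ-item `MuInequalityStabilized`, `PrintHypothesesDischargeX10b`, glue `…OfStabilized`} pending tenure)

HONEST FRAMING: a SKELETON; `sorry` ONLY in `stub_muPartStabilizedOfPrint`, whose letter IS the cell's ONE shared μ-item
text `HeegnerMuPartStabilized.MuPartStabilizedOfPrint` (p625984; MZ26 Thm 3.15's printed hypotheses with `p ∣ h_K` in
place of `p ∤ h_K`, stabilised class, length at `(p)`; BEYOND citable PRINT per REF-118) — the same registered residual as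
row 9's skeleton v7 on 27077 (one item, two rows; director-bsd g13 10:02:41Z (1)). Everything else is LANDED: the row-10
letter `PrintX10bSharpMuStabilized.Stmt.muInequalityStabilized` and its closer (p625072), the `3 ∤ h_K` regime (p607508),
the sharp envelope (p621830). The composition `HowardContainmentLightFrameX10bPinnedOfPrint_of_stubs` concludes the crux BY
NAME: shared letter ⟹ (X10.thm413Hypotheses_of_classX10, ClassX10.irr, ClassX10.hasPadicScalarImage_of_not_surj) row letter
⟹ (p625072) crux. v2 (rev35, row-letter stub, evidence #4 / Lines/torsion_depth_x10b_pinned_rev35.lean) stays as record.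
Nothing closed; no summit statement proved; BSD is not proved by any of this.
-/

set_option linter.dupNamespace false
set_option autoImplicit false

noncomputable section

open scoped Classical Pointwise
open Literature Literature.NumberTheory.EllipticCurves WeierstrassCurve
  Literature.NumberTheory.EllipticCurves.ModularForms
  Literature.NumberTheory.EllipticCurves.CastellaGrossiLeeSkinner2022
open Literature.NumberTheory.EllipticCurves.Rank1Residual (ClassX10 Surj)
open Summit.BirchSwinnertonDyer.BirchSwinnertonDyer.Theorems.HeegnerMuPartStabilized (MuPartStabilizedOfPrint)
open Summit.BirchSwinnertonDyer.BirchSwinnertonDyer.Theorems (PrintX10bSharpMuStabilized.Stmt.muInequalityStabilized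
  PrintX10bSharpMuStabilized.howardContainmentLightFrameX10bPinnedOfPrint_of_muStabilized)

namespace Summit.BirchSwinnertonDyer.BirchSwinnertonDyer.Cruxes.HowardContainmentLightFrameX10bPinnedOfPrint.TorsionDepthX10bPinned

open Summit.BirchSwinnertonDyer.BirchSwinnertonDyer.Theses.PrintX10b (HowardContainmentLightFrameX10bPinnedOfPrint)

/-! ## §1 The one stub: the shared μ-item letter -/

/-- **stub s_mu♭ (OPEN; the cell's ONE shared μ-residual for rows 9 and 10, letter = `MuPartStabilizedOfPrint` p625984
VERBATIM by name): `Thm413Hypotheses N W K p κ γ → ¬CM → irr_ℚ → irr_K → MZ26 scalar image → p split → p ∣ h_K → ∀ D C X,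
𝔖 f.g. → 𝒳 f.g. → IsTorsion(𝔖/Λκ_∞(C)) → length_(p)(𝒳_tors) ≤ 2·length_(p)(𝔖/Λκ_∞(C))`. BEYOND CITABLE PRINT at
`p ∣ h_K` (REF-118): MZ26 Thm 3.15 (iii) re-based per CGLS22 §4.1 / Howard 2004 Thm 2.2.10 `q_m`-device; in the tree it is
⟸ the specialised index inequality hKS_stab (x10b-p1 LEAD g3, p626469).**
[cite: MastellaZerman2026, Thm. 3.15 (iii), Assumptions 2.1 and 2.13 (v)] [cite: Howard2004HeegnerKolyvagin, Thm. 2.2.10]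
[cite: CastellaGrossiLeeSkinner2022, §4.1, Thm. 4.1.1] -/
theorem stub_muPartStabilizedOfPrint : MuPartStabilizedOfPrint := by
  sorry

/-! ## §2 Composition (sorry-free): shared letter ⟹ row-10 letter ⟹ crux -/

/-- **Shared μ-letter ⟹ row-10 letter** (the X10b frame discharges the shared letter's extra binders in the kernel:
`X10.thm413Hypotheses_of_classX10` p606553, `ClassX10.irr`, `ClassX10.hasPadicScalarImage_of_not_surj`; rank/Ш idle).
[cite: LombardoTronto2022, Prop. 3.12] [cite: MastellaZerman2026, Assumption 2.13 (v)] -/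
theorem rowLetter_of_common (h : MuPartStabilizedOfPrint) : PrintX10bSharpMuStabilized.Stmt.muInequalityStabilized := by
  intro W _ _ p _ _ K _ _ hX hns hcm hK hodd h3 hHN hHp hirr κ hκ γ hγ _ _ hhK jbar D C X hfS hfX htor 𝔭 h𝔭
  have hirrQ : W.HasIrreducibleModPGaloisRep p := by
    obtain ⟨rfl, -⟩ := id hX
    exact hX.irr
  exact h (W.conductorNorm ℤ) W K p κ γ jbar
    (Summit.BirchSwinnertonDyer.BirchSwinnertonDyer.Rank1Residual.X10.thm413Hypotheses_of_classX10 hX hK h3 hHN hHp hodd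
      hκ hγ)
    hcm hirrQ hirr (Rank1Residual.ClassX10.hasPadicScalarImage_of_not_surj hX hns) hHp hhK D C X hfS hfX htor 𝔭 h𝔭

/-- Local ALIAS of the crux decl (only `…_of_stubs` concludes the crux by name, for the registry audit). -/
def Goal : Prop := HowardContainmentLightFrameX10bPinnedOfPrint

/-- **Composition**: crux ⟸ shared letter, by the landed closer p625072 after the specialisation. -/
theorem HowardContainmentLightFrameX10bPinnedOfPrint_of (s_mu : MuPartStabilizedOfPrint) : Goal :=
  (PrintX10bSharpMuStabilized.howardContainmentLightFrameX10bPinnedOfPrint_of_muStabilized (rowLetter_of_common s_mu) :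
    HowardContainmentLightFrameX10bPinnedOfPrint)

/-- the composed line (sorry only through `stub_muPartStabilizedOfPrint`). -/
theorem HowardContainmentLightFrameX10bPinnedOfPrint_of_stubs : HowardContainmentLightFrameX10bPinnedOfPrint :=
  (HowardContainmentLightFrameX10bPinnedOfPrint_of stub_muPartStabilizedOfPrint : Goal)

end Summit.BirchSwinnertonDyer.BirchSwinnertonDyer.Cruxes.HowardContainmentLightFrameX10bPinnedOfPrint.TorsionDepthX10bPinned

end
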